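import Literature.GroupTheory.KleinFourCrossedHom
import Mathlib.GroupTheory.Coset.Basic
import Mathlib.Algebra.BigOperators.Group.Finset.Basic
import HarnessLib

/-!
# The transfer of a Klein-four-valued crossed homomorphism, read through the character of a point, is trivial
# (the group theory of `N_{K/k} ∘ (x − θ) ≡ 1` for the general `2`-descent)

Topic `GroupTheory`; namespace `Literature.GroupTheory.KleinCocycle` (sequel of `KleinFourCrossedHom.lean`).
Theorems only (no definition, no named fact, no `sorry`).

Let a group `G` act by automorphisms on an abelian group `V = {0, T, T₂, T₃}` which is a Klein four-group
(`T + T₂ = T₃`, exponent `2`) WITHOUT non-zero fixed vector, let `N ≤ G` be the stabiliser of `T` (so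
`(G : N) = 3`, the orbit of `T` being `{T, T₂, T₃}`), `s : G/N → G` coset representatives, and let
`χ_S(P) = +1` if `P ∈ {0, S}`, `−1` otherwise (the "Weil pairing with `S`", read in any commutative ring `R`).
For a crossed homomorphism `φ : G → V` (`φ(gh) = φ(g) + g•φ(h)`) and `g ∈ G`, the TRANSFER of the
`N`-cocycle `χ_T ∘ φ|_N` evaluated at `g` is the product over the cosets `x` of `χ_T(φ(s(gx)⁻¹ g s(x)))`
(Neukirch–Schmidt–Wingberg I.§5; the tree's `transferFun`). Main result **`prod_sign_apply_schreier_eq_one`**: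

  `∏_{x ∈ G/N} χ_T(φ(s(g·x)⁻¹ · g · s(x))) = 1` for every `g ∈ G`.

Proof: with `u = s(g·x)`, `φ(u⁻¹ g s(x)) = u⁻¹ • (φ(u) + φ(g) + g • φ(s x))` (cocycle rule, `−v = v`), and
`χ_T(u⁻¹ • Q) = χ_{u•T}(Q)`, `u • T = g • (s(x) • T)` (the Schreier element fixes `T`); `χ_S` is multiplicative
on `V` (`sign_add`) and `χ_{a•S}(a•P) = χ_S(P)` (`sign_smul`); so the `x`-th factor is
`A(g·x) · B(g·x) · A(x)` with `A(y) = χ_{s(y)•T}(φ(s y))`, `B(y) = χ_{s(y)•T}(φ g)`; reindexing by `x ↦ g·x`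
the product is `(∏ A)² · ∏_y χ_{s(y)•T}(φ g) = 1 · 1`, because `y ↦ s(y)•T` is a bijection of `G/N` onto
`{T, T₂, T₃}` (`prod_orbit_eq`) and `χ_T · χ_{T₂} · χ_{T₃} ≡ 1` (`sign_mul_sign_mul_sign`).

Application (sequel `Literature/NumberTheory/EllipticCurves/TwoDescentOneRootNorm.lean`): `G = Γ_k`, `V = E[2]`,
`T = T_θ` for a root `θ` of the irreducible `2`-division cubic, `N = Gal(k̄/k(θ))`: the corestriction of
`H¹(χ_θ) ∘ res (c)` vanishes, i.e. `N_{k(θ)/k}` of Cassels' class `x − θ` of ANY `c ∈ H¹(k, E[2])` is a square in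
`k` (Cassels, LMSST 24, §15: `Norm(a − Θ) = F(a) ∈ k*²` for points; here for all of `H¹`). Seat `bsd-line-spt-p1`
(g29).

## References

* [NeukirchSchmidtWingberg2008] J. Neukirch, A. Schmidt, K. Wingberg, *Cohomology of Number Fields*, 2nd ed.
  (2008), Ch. I §5 (corestriction / transfer on inhomogeneous cochains).
* [SerreGaloisCohomology1997] J.-P. Serre, *Galois Cohomology*, Springer 1997, I.§2.4, I.§5.1.
* [Cassels1991LecturesEllipticCurves] J. W. S. Cassels, *Lectures on Elliptic Curves*, LMSST 24, CUP 1991, §15.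
-/

open scoped Classical

namespace Literature.GroupTheory.KleinCocycle

variable {G V : Type*} [Group G] [AddCommGroup V] [DistribMulAction G V]

/-! ## The sign `χ_S(P) = [P ∈ {0, S}] ∈ {±1}` -/

section Sign

variable (R : Type*) [CommRing R]

omit [Group G] [DistribMulAction G V] in
/-- `χ_S(P)² = 1`. [cite: SerreGaloisCohomology1997, I.§5.1] -/
theorem sign_mul_self (S P : V) :
    (if P = 0 ∨ P = S then (1 : R) else -1) * (if P = 0 ∨ P = S then (1 : R) else -1) = 1 := by
  split_ifs <;> simp

omit [Group G] [DistribMulAction G V] in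
/-- **`χ_S` is a character of the Klein four-group** for `S ≠ 0`: `χ_S(P + Q) = χ_S(P) χ_S(Q)` (`{0, S}` is a
subgroup of index `2`). [cite: SerreGaloisCohomology1997, I.§5.1] -/
theorem sign_add {T T₂ T₃ : V} (h0T : T ≠ 0) (h02 : T₂ ≠ 0) (h03 : T₃ ≠ 0) (h12 : T ≠ T₂) (h13 : T ≠ T₃)
    (h23 : T₂ ≠ T₃) (hadd : T + T₂ = T₃) (hTT : T + T = 0) (h22 : T₂ + T₂ = 0)
    (hall : ∀ v : V, v = 0 ∨ v = T ∨ v = T₂ ∨ v = T₃) {S : V} (hS : S ≠ 0) (P Q : V) :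
    (if P + Q = 0 ∨ P + Q = S then (1 : R) else -1) =
      (if P = 0 ∨ P = S then (1 : R) else -1) * (if Q = 0 ∨ Q = S then (1 : R) else -1) := by
  have t13 : T + T₃ = T₂ := klein_add₁₃ hadd hTT
  have t23 : T₂ + T₃ = T := klein_add₂₃ hadd h22
  have t33 : T₃ + T₃ = 0 := klein_add₃₃ hadd hTT h22
  have t21 : T₂ + T = T₃ := by rw [add_comm]; exact hadd
  have t31 : T₃ + T = T₂ := by rw [add_comm]; exact t13
  have t32 : T₃ + T₂ = T := by rw [add_comm]; exact t23
  rcases hall S with rfl | rfl | rfl | rfl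
  · exact absurd rfl hS
  all_goals
    rcases hall P with rfl | rfl | rfl | rfl <;> rcases hall Q with rfl | rfl | rfl | rfl <;>
      simp [hadd, hTT, h22, t13, t23, t33, t21, t31, t32, h0T, h02, h03, h12, h13, h23, h0T.symm, h02.symm,
        h03.symm, h12.symm, h13.symm, h23.symm]

omit [Group G] [DistribMulAction G V] in
/-- **`χ_T · χ_{T₂} · χ_{T₃} ≡ 1`** on the Klein four-group (each non-zero point lies in exactly one of the three
subgroups `{0, S}`). [cite: SerreGaloisCohomology1997, I.§5.1] -/
theorem sign_mul_sign_mul_sign {T T₂ T₃ : V} (h0T : T ≠ 0) (h02 : T₂ ≠ 0) (h03 : T₃ ≠ 0) (h12 : T ≠ T₂)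
    (h13 : T ≠ T₃) (h23 : T₂ ≠ T₃) (hall : ∀ v : V, v = 0 ∨ v = T ∨ v = T₂ ∨ v = T₃) (P : V) :
    (if P = 0 ∨ P = T then (1 : R) else -1) * (if P = 0 ∨ P = T₂ then (1 : R) else -1) *
      (if P = 0 ∨ P = T₃ then (1 : R) else -1) = 1 := by
  rcases hall P with rfl | rfl | rfl | rfl <;>
    simp [h0T, h02, h03, h12, h13, h23, h0T.symm, h02.symm, h03.symm, h12.symm, h13.symm, h23.symm]

/-- **Equivariance**: `χ_{a•S}(a•P) = χ_S(P)` (`a` acts by a group automorphism).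
[cite: SerreGaloisCohomology1997, I.§5.1] -/
theorem sign_smul (a : G) (S P : V) :
    (if a • P = 0 ∨ a • P = a • S then (1 : R) else -1) = (if P = 0 ∨ P = S then (1 : R) else -1) := by
  have h0 : a • P = 0 ↔ P = 0 := by
    constructor
    · intro h
      by_contra hP
      exact smul_ne_zero_of_ne_zero a hP h
    · rintro rfl; exact smul_zero a
  have hS : a • P = a • S ↔ P = S := ⟨fun h => smul_left_cancel a h, fun h => by rw [h]⟩
  simp only [h0, hS]

end Sign

/-! ## The orbit of `T`: `G/N ≃ {T, T₂, T₃}` -/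

section Orbit

variable {T T₂ T₃ : V} (N : Subgroup G) (hN : ∀ g : G, g ∈ N ↔ g • T = T)
  {s : G ⧸ N → G} (hs : ∀ x : G ⧸ N, (s x : G ⧸ N) = x)
include hN hs

/-- `x ↦ s(x) • T` is injective on `G/N` (`N` is the stabiliser of `T`). [cite: SerreGaloisCohomology1997, I.§5.1] -/
theorem smul_rep_injective : Function.Injective fun x : G ⧸ N => s x • T := by
  intro x y hxy
  simp only at hxy
  have hmem : (s y)⁻¹ * s x ∈ N := by
    rw [hN, mul_smul, hxy, inv_smul_smul]
  rw [← hs x, ← hs y]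
  exact (QuotientGroup.eq.mpr hmem).symm

/-- The representative of the coset of `a` moves `T` where `a` does: `s(aN) • T = a • T`.
[cite: SerreGaloisCohomology1997, I.§5.1] -/
theorem smul_rep_mk (a : G) : s (a : G ⧸ N) • T = a • T := by
  have hmem : a⁻¹ * s (a : G ⧸ N) ∈ N := QuotientGroup.eq.mp (hs (a : G ⧸ N)).symm
  rw [hN, mul_smul] at hmem
  have := congrArg (fun v => a • v) hmem
  simpa only [smul_inv_smul] using this

/-- `s(g · x) • T = g • (s(x) • T)`: the Schreier element `s(g·x)⁻¹ g s(x) ∈ N` fixes `T`.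
[cite: NeukirchSchmidtWingberg2008, Ch. I §5] -/
theorem smul_rep_smul (g : G) (x : G ⧸ N) : s (g • x) • T = g • s x • T := by
  have hmem : (s (g • x))⁻¹ * (g * s x) ∈ N := by
    rw [← QuotientGroup.eq, hs (g • x), ← smul_eq_mul g (s x), ← MulAction.Quotient.smul_coe, hs x]
  rw [hN, mul_smul, mul_smul] at hmem
  have := congrArg (fun v => s (g • x) • v) hmem
  simp only [smul_inv_smul] at this
  exact this.symm

/-- **The orbit of `T` is `{T, T₂, T₃}`, each reached by exactly one coset**: for every function `F` on `V`,
`∏_{x ∈ G/N} F(s(x) • T) = F(T) · F(T₂) · F(T₃)` (no non-zero fixed vector ⇒ transitivity,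
`exists_smul_eq₁₂`; injectivity by `N = Stab T`). [cite: SilvermanAEC2009, Prop. X.1.4 (E[2] as a Galois set)] -/
theorem prod_orbit_eq [Fintype (G ⧸ N)] (h0T : T ≠ 0) (h02 : T₂ ≠ 0) (h03 : T₃ ≠ 0) (h12 : T ≠ T₂)
    (h13 : T ≠ T₃) (h23 : T₂ ≠ T₃) (hadd : T + T₂ = T₃) (hTT : T + T = 0)
    (hall : ∀ v : V, v = 0 ∨ v = T ∨ v = T₂ ∨ v = T₃) (hfix : ∀ v : V, v ≠ 0 → ∃ g : G, g • v ≠ v)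
    {M : Type*} [CommMonoid M] (F : V → M) :
    ∏ x : G ⧸ N, F (s x • T) = F T * F T₂ * F T₃ := by
  classical
  -- the three cosets reaching `T`, `T₂`, `T₃`
  have hadd' : T + T₃ = T₂ := klein_add₁₃ hadd hTT
  have hall' : ∀ v : V, v = 0 ∨ v = T ∨ v = T₃ ∨ v = T₂ := fun v => by
    rcases hall v with h | h | h | h
    · exact Or.inl h
    · exact Or.inr (Or.inl h)
    · exact Or.inr (Or.inr (Or.inr h))
    · exact Or.inr (Or.inr (Or.inl h))
  obtain ⟨a₂, ha₂⟩ := exists_smul_eq₁₂ h0T h02 h12 hadd hTT hall hfix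
  obtain ⟨a₃, ha₃⟩ := exists_smul_eq₁₂ h0T h03 h13 hadd' hTT hall' hfix
  set x₁ : G ⧸ N := ((1 : G) : G ⧸ N)
  set x₂ : G ⧸ N := (a₂ : G ⧸ N)
  set x₃ : G ⧸ N := (a₃ : G ⧸ N)
  have hx₁ : s x₁ • T = T := by rw [smul_rep_mk N hN hs, one_smul]
  have hx₂ : s x₂ • T = T₂ := by rw [smul_rep_mk N hN hs, ha₂]
  have hx₃ : s x₃ • T = T₃ := by rw [smul_rep_mk N hN hs, ha₃]
  have hinj := smul_rep_injective N hN hs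
  have h12' : x₁ ≠ x₂ := fun h => h12 (by rw [← hx₁, ← hx₂, h])
  have h13' : x₁ ≠ x₃ := fun h => h13 (by rw [← hx₁, ← hx₃, h])
  have h23' : x₂ ≠ x₃ := fun h => h23 (by rw [← hx₂, ← hx₃, h])
  -- every coset is one of them
  have huniv : (Finset.univ : Finset (G ⧸ N)) = {x₁, x₂, x₃} := by
    ext x
    simp only [Finset.mem_univ, Finset.mem_insert, Finset.mem_singleton, true_iff]
    rcases hall (s x • T) with h | h | h | h
    · exact absurd h (smul_ne_zero_of_ne_zero (s x) h0T)
    · exact Or.inl (hinj (h.trans hx₁.symm))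
    · exact Or.inr (Or.inl (hinj (h.trans hx₂.symm)))
    · exact Or.inr (Or.inr (hinj (h.trans hx₃.symm)))
  rw [huniv, Finset.prod_insert (by simp [h12', h13']), Finset.prod_insert (by simp [h23']),
    Finset.prod_singleton, hx₁, hx₂, hx₃, mul_assoc]

end Orbit

/-! ## The transfer product -/

omit [DistribMulAction G V] in
/-- A crossed homomorphism vanishes at `1`. [cite: SerreGaloisCohomology1997, I.§5.1] -/
theorem crossedHom_one [DistribMulAction G V] (φ : G → V) (hφ : ∀ g h : G, φ (g * h) = φ g + g • φ h) :
    φ 1 = 0 := by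
  have h := hφ 1 1
  rw [mul_one, one_smul, left_eq_add] at h
  exact h

/-- `φ(u⁻¹) = −u⁻¹ • φ(u)` for a crossed homomorphism. [cite: SerreGaloisCohomology1997, I.§5.1] -/
theorem crossedHom_inv (φ : G → V) (hφ : ∀ g h : G, φ (g * h) = φ g + g • φ h) (u : G) :
    φ u⁻¹ = -(u⁻¹ • φ u) := by
  have h := hφ u⁻¹ u
  rw [inv_mul_cancel, crossedHom_one φ hφ] at h
  rw [eq_neg_iff_add_eq_zero, ← h]

/-- **The value of `φ` at a Schreier element**: `φ(u⁻¹ g v) = u⁻¹ • (φ u + φ g + g • φ v)` in the Klein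
four-group (`−w = w`). [cite: NeukirchSchmidtWingberg2008, Ch. I §5] -/
theorem apply_schreier_eq {T T₂ T₃ : V} (hadd : T + T₂ = T₃) (hTT : T + T = 0) (h22 : T₂ + T₂ = 0)
    (hall : ∀ v : V, v = 0 ∨ v = T ∨ v = T₂ ∨ v = T₃)
    (φ : G → V) (hφ : ∀ g h : G, φ (g * h) = φ g + g • φ h) (u g v : G) :
    φ (u⁻¹ * g * v) = u⁻¹ • (φ u + φ g + g • φ v) := by
  rw [hφ, hφ, crossedHom_inv φ hφ, klein_neg hadd hTT h22 hall, mul_smul, smul_add, smul_add]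

/-- **The transfer of `χ_T ∘ φ` is trivial.** For `G` acting on the Klein four-group `V = {0, T, T₂, T₃}` without
non-zero fixed vector, `N = Stab_G(T)` with coset representatives `s`, a crossed homomorphism `φ : G → V`, and any
`g ∈ G`: `∏_{x ∈ G/N} χ_T(φ(s(g·x)⁻¹ g s(x))) = 1`, where `χ_T(P) = 1` if `P ∈ {0, T}` and `−1` otherwise — the
degree-`1` transfer (corestriction) of the `N`-cocycle `χ_T ∘ φ|_N`, on cocycles, vanishes identically.
[cite: NeukirchSchmidtWingberg2008, Ch. I §5] [cite: Cassels1991LecturesEllipticCurves, §15 (Norm(a − Θ) ∈ k*²)] -/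
theorem prod_sign_apply_schreier_eq_one {T T₂ T₃ : V} (h0T : T ≠ 0) (h02 : T₂ ≠ 0) (h03 : T₃ ≠ 0)
    (h12 : T ≠ T₂) (h13 : T ≠ T₃) (h23 : T₂ ≠ T₃) (hadd : T + T₂ = T₃) (hTT : T + T = 0) (h22 : T₂ + T₂ = 0)
    (hall : ∀ v : V, v = 0 ∨ v = T ∨ v = T₂ ∨ v = T₃) (hfix : ∀ v : V, v ≠ 0 → ∃ g : G, g • v ≠ v)
    (N : Subgroup G) (hN : ∀ g : G, g ∈ N ↔ g • T = T) [Fintype (G ⧸ N)]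
    {s : G ⧸ N → G} (hs : ∀ x : G ⧸ N, (s x : G ⧸ N) = x)
    (φ : G → V) (hφ : ∀ g h : G, φ (g * h) = φ g + g • φ h) (R : Type*) [CommRing R] (g : G) :
    ∏ x : G ⧸ N, (if φ ((s (g • x))⁻¹ * g * s x) = 0 ∨ φ ((s (g • x))⁻¹ * g * s x) = T then (1 : R) else -1) =
      1 := by
  classical
  -- the factors `A(y) = χ_{s(y)•T}(φ(s y))`, `B(y) = χ_{s(y)•T}(φ g)`
  set A : G ⧸ N → R := fun y => if φ (s y) = 0 ∨ φ (s y) = s y • T then 1 else -1 with hA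
  set B : G ⧸ N → R := fun y => if φ g = 0 ∨ φ g = s y • T then 1 else -1 with hB
  have hne : ∀ y : G ⧸ N, s y • T ≠ 0 := fun y => smul_ne_zero_of_ne_zero (s y) h0T
  -- the `x`-th factor is `A(g·x) · B(g·x) · A(x)`
  have hterm : ∀ x : G ⧸ N,
      (if φ ((s (g • x))⁻¹ * g * s x) = 0 ∨ φ ((s (g • x))⁻¹ * g * s x) = T then (1 : R) else -1) =
        A (g • x) * B (g • x) * A x := by
    intro x
    set u := s (g • x) with hu
    rw [apply_schreier_eq hadd hTT h22 hall φ hφ u g (s x)]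
    -- `χ_T(u⁻¹ • Q) = χ_{u•T}(Q)`
    have h1 : (if u⁻¹ • (φ u + φ g + g • φ (s x)) = 0 ∨ u⁻¹ • (φ u + φ g + g • φ (s x)) = T then (1 : R)
        else -1) = (if φ u + φ g + g • φ (s x) = 0 ∨ φ u + φ g + g • φ (s x) = u • T then (1 : R) else -1) := by
      rw [← sign_smul R u T (u⁻¹ • (φ u + φ g + g • φ (s x))), smul_inv_smul]
    rw [h1, sign_add R h0T h02 h03 h12 h13 h23 hadd hTT h22 hall (hne (g • x)),
      sign_add R h0T h02 h03 h12 h13 h23 hadd hTT h22 hall (hne (g • x))]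
    -- third factor: `u • T = g • (s x • T)` and equivariance
    have h3 : (if g • φ (s x) = 0 ∨ g • φ (s x) = u • T then (1 : R) else -1) = A x := by
      rw [hu, smul_rep_smul N hN hs g x, sign_smul R g (s x • T) (φ (s x))]
    rw [h3]
  rw [Finset.prod_congr rfl fun x _ => hterm x, Finset.prod_mul_distrib, Finset.prod_mul_distrib]
  -- reindex the first two products along `x ↦ g • x`
  have hreA : ∏ x : G ⧸ N, A (g • x) = ∏ y : G ⧸ N, A y := Equiv.prod_comp (MulAction.toPerm g) A
  have hreB : ∏ x : G ⧸ N, B (g • x) = ∏ y : G ⧸ N, B y := Equiv.prod_comp (MulAction.toPerm g) B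
  rw [hreA, hreB]
  -- `∏ B = χ_T(φ g) χ_{T₂}(φ g) χ_{T₃}(φ g) = 1`
  have hBprod : ∏ y : G ⧸ N, B y = 1 := by
    rw [hB, prod_orbit_eq N hN hs h0T h02 h03 h12 h13 h23 hadd hTT hall hfix
      (fun S => if φ g = 0 ∨ φ g = S then (1 : R) else -1)]
    exact sign_mul_sign_mul_sign R h0T h02 h03 h12 h13 h23 hall (φ g)
  -- `(∏ A)² = 1`
  have hAprod : (∏ y : G ⧸ N, A y) * ∏ y : G ⧸ N, A y = 1 := by
    rw [← Finset.prod_mul_distrib]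
    exact Finset.prod_eq_one fun y _ => sign_mul_self R (s y • T) (φ (s y))
  calc (∏ y : G ⧸ N, A y) * (∏ y : G ⧸ N, B y) * ∏ x : G ⧸ N, A x
      = ((∏ y : G ⧸ N, A y) * ∏ y : G ⧸ N, A y) * ∏ y : G ⧸ N, B y := by ring
    _ = 1 := by rw [hAprod, hBprod, one_mul]

end Literature.GroupTheory.KleinCocycle
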